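import Mathlib.LinearAlgebra.Matrix.Rank
import Mathlib.LinearAlgebra.Matrix.ToLin
import Mathlib.LinearAlgebra.Matrix.Nondegenerate
import Mathlib.LinearAlgebra.FiniteDimensional.Lemmas
import Mathlib.LinearAlgebra.FreeModule.Finite.Matrix
import Mathlib.Algebra.Polynomial.Roots
import HarnessLib

/-!
# Flanders' theorem: a space of linear maps of rank `≤ r` has dimension `≤ r · max(dim E, dim F)` (infinite fields)

Topic `LinearAlgebra/Matrix`, namespace `Literature.LinearAlgebra.Matrix`.

* H. Flanders, *On spaces of linear transformations with bounded rank*, J. London Math. Soc.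
  37 (1962) 10–16 [Flanders1962]: "subspaces `X` of `M_{m×n}` … with the property that each
  matrix of `X` has rank at most `r` … necessarily have dimension at most `max(mr, nr)`" (as
  quoted by Atkinson–Lloyd, Quart. J. Math. 31 (1980), p. 253, held text
  `paper:doi-10-1093-qmath-31-3-253` p. 1), proved by Flanders for ground fields with at least
  `r + 1` elements; R. Meshulam, Quart. J. Math. 36 (1985) 225–229 removed the restriction on the
  field (not needed and not vendored here). The paper itself is paywalled (acquisition request
  filed); the statement is taken from the two held sources quoting it.
* Used by Blasiak–Church–Cohn–Grochow–Umans 2017, App. B, proof of Prop. B.6 ("a theorem of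
  Flanders says that a subspace of `n × n` matrices in which every matrix has rank at most `r`
  must have dimension at most `rn`", held text `paper:arxiv-1712.02302` p. 14) to show that the
  slice rank of the matrix multiplication tensor `⟨n,n,n⟩` is `n²`
  (`Literature.Barriers.MatrixMultiplication.BCCGU2017_propB6`).

## What is proved

`finrank_le_of_forall_finrank_range_le`: over an INFINITE field `K`, a subspace `W` of
`E →ₗ[K] F` (`E`, `F` finite-dimensional) all of whose members have rank `≤ r` satisfies
`finrank W ≤ r · max (finrank E) (finrank F)`; `finrank_le_of_forall_rank_le` is the same for a
subspace of `Matrix m n K` and `Matrix.rank`. This is the infinite-field case of the result of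
Flanders (his hypothesis is `|K| ≥ r + 1`); the equality cases are not treated.

## The proof given here (coordinate-free; not Flanders' determinantal argument)

Let `f₀ ∈ W` have maximal rank `ρ`, `E₀ = ker f₀`, `F₁ = range f₀`.
1. `mem_range_of_forall_mem_range_add_smul`: if `y ∈ range (f₀ + s g)` for every `s ≠ 0`
   (`g ∈ W`) then `y ∈ F₁` — otherwise `y` together with a basis of `F₁` is an independent
   family, which stays independent after the perturbation `f₀ wᵢ ↦ (f₀ + s g) wᵢ` for all but
   finitely many `s` (`finite_setOf_not_linearIndependent_add_smul`: `det (1 + s N)` is a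
   nonzero polynomial in `s`), so that `rank (f₀ + s g) ≥ ρ + 1` for some `s`, contradicting
   maximality. Hence (`apply_mem_range_of_mem_ker`) `g(E₀) ⊆ F₁` and
   (`apply_mem_range_of_apply_eq`) `g w ∈ F₁` whenever `f₀ w = g v`, `v ∈ E₀`; the latter
   polarises (`apply_add_apply_mem_range`). These are the identities `A₄ = 0`, `A₃A₂ = 0` of the
   classical block-matrix proof.
2. Dimension count (`finrank_le_of_forall_finrank_range_le_aux`): with
   `S = span {g v : g ∈ W, v ∈ E₀} ≤ F₁` (`dim S = s ≤ ρ`) and `T = f₀⁻¹(S)` (`dim T ≥ dim E₀ + s`),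
   restriction to `E₀` maps `W` into `Hom(E₀, S)`; its kernel, composed with `F → F/F₁`, lands in
   the maps vanishing on `T` (by the polarised identity); and what is left vanishes on `E₀` with
   values in `F₁`. Summing, `dim W ≤ (n−ρ)s + (ρ−s)(m−ρ) + ρ² ≤ ρ · max(n, m)`.

## Not here

Finite fields (Meshulam 1985), the classification of the extremal spaces (Flanders,
Atkinson–Lloyd, de Seguins Pazzis), affine subspaces.
-/

noncomputable section

open Polynomial

namespace Literature.LinearAlgebra.Matrix


variable {K : Type*} [Field K]
variable {E : Type*} [AddCommGroup E] [Module K E]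
variable {F : Type*} [AddCommGroup F] [Module K F]

section Generic

variable {ι : Type*} [Fintype ι] [DecidableEq ι]

/-- **Generic perturbations keep a family independent.** If `u : ι → F` is linearly independent
(finite `ι`) and `u' : ι → F` is arbitrary, then `u + s • u'` is linearly independent for all but
finitely many scalars `s`: with `φ` a left inverse of the linear-combination map of `u`, the
matrix of `φ ∘ (u + s u')` is `1 + s N`, whose determinant is a polynomial in `s` with value `1`
at `s = 0`. [folklore] -/
theorem finite_setOf_not_linearIndependent_add_smul {u : ι → F} (hu : LinearIndependent K u)
    (u' : ι → F) :
    Set.Finite {s : K | ¬ LinearIndependent K (fun i => u i + s • u' i)} := by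
  classical
  -- the linear-combination map of `u` is injective: choose a left inverse `φ`
  have hker : LinearMap.ker (Fintype.linearCombination K u) = ⊥ := by
    rw [LinearMap.ker_eq_bot']
    intro g hg
    funext i
    exact Fintype.linearIndependent_iff.1 hu g hg i
  obtain ⟨φ, hφ⟩ := LinearMap.exists_leftInverse_of_injective _ hker
  have hφu : ∀ i j, φ (u i) j = if i = j then (1 : K) else 0 := by
    intro i j
    have h := congrArg (fun f => f (Pi.single i (1 : K)) j) hφ
    simp only [LinearMap.comp_apply, Fintype.linearCombination_apply_single, one_smul,
      LinearMap.id_apply] at h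
    rw [h, Pi.single_apply]
    by_cases hij : i = j
    · simp [hij]
    · simp [hij, Ne.symm hij]
  -- the matrix `N` of `φ ∘ u'` and the polynomial `det (1 + X • N)`
  set N : _root_.Matrix ι ι K := Matrix.of fun i j => φ (u' i) j with hN
  set P : K[X] := Matrix.det ((1 : _root_.Matrix ι ι K[X]) + (X : K[X]) • N.map C) with hP
  have hPeval : ∀ s : K, P.eval s = Matrix.det (1 + s • N) := by
    intro s
    have h := RingHom.map_det (Polynomial.evalRingHom s)
      ((1 : _root_.Matrix ι ι K[X]) + (X : K[X]) • N.map C)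
    rw [Polynomial.coe_evalRingHom] at h
    rw [hP, h]
    congr 1
    ext i j
    simp [RingHom.mapMatrix_apply, Matrix.map_apply, Matrix.one_apply, apply_ite (Polynomial.eval s)]
    ring
  have hP0 : P ≠ 0 := by
    intro h0
    have := hPeval 0
    rw [h0, Polynomial.eval_zero, zero_smul, add_zero, Matrix.det_one] at this
    exact zero_ne_one this
  refine (Polynomial.finite_setOf_isRoot hP0).subset ?_
  intro s hs
  simp only [Set.mem_setOf_eq] at hs ⊢
  by_contra hdet
  apply hs
  rw [Polynomial.IsRoot.def, hPeval] at hdet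
  rw [Fintype.linearIndependent_iff]
  intro g hg i
  -- apply `φ` to the relation: the coefficient vector is killed by `1 + s • N`
  have hrow : Matrix.vecMul g (1 + s • N) = 0 := by
    have h := congrArg φ hg
    simp only [map_sum, map_smul, map_add, map_zero] at h
    funext j
    have hj := congrFun h j
    simp only [Finset.sum_apply, Pi.smul_apply, Pi.add_apply, smul_eq_mul, Pi.zero_apply,
      hφu] at hj
    simp only [Matrix.vecMul, dotProduct, Matrix.add_apply, Matrix.one_apply, Matrix.smul_apply,
      hN, Matrix.of_apply, smul_eq_mul, Pi.zero_apply]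
    refine Eq.trans (Finset.sum_congr rfl fun k _ => ?_) hj
    ring
  exact congrFun (Matrix.eq_zero_of_vecMul_eq_zero hdet hrow) i

end Generic

section MaxRank

variable [Infinite K] [FiniteDimensional K F]

/-- **Key lemma (maximal rank).** Let `f₀` have maximal rank among the members of a subspace `W`
of linear maps over an infinite field, and let `g ∈ W`. If `y ∈ range (f₀ + s • g)` for every
`s ≠ 0`, then `y ∈ range f₀`: otherwise `y` and a basis of `range f₀` form an independent family
of `rank f₀ + 1` vectors which, after the perturbation `f₀ wᵢ ↦ (f₀ + s g) wᵢ`, is still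
independent for some admissible `s` (`finite_setOf_not_linearIndependent_add_smul`) and lies in
`range (f₀ + s g)`, contradicting maximality. [folklore] -/
theorem mem_range_of_forall_mem_range_add_smul {W : Submodule K (E →ₗ[K] F)} {f₀ g : E →ₗ[K] F}
    (hf₀ : f₀ ∈ W) (hg : g ∈ W)
    (hmax : ∀ h ∈ W, Module.finrank K (LinearMap.range h) ≤ Module.finrank K (LinearMap.range f₀))
    {y : F} (hy : ∀ s : K, s ≠ 0 → y ∈ LinearMap.range (f₀ + s • g)) :
    y ∈ LinearMap.range f₀ := by
  classical
  by_contra hyn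
  set ρ := Module.finrank K (LinearMap.range f₀) with hρ
  -- a basis of `range f₀` and preimages of its vectors
  let b := Module.finBasis K (LinearMap.range f₀)
  have hw : ∀ i, ∃ w : E, f₀ w = b i := fun i => LinearMap.mem_range.1 (b i).2
  choose w hw using hw
  -- the two families: `u` (independent) and the direction `u'`
  let u : Fin (ρ + 1) → F := Fin.cons y fun i => (b i : F)
  let u' : Fin (ρ + 1) → F := Fin.cons 0 fun i => g (w i)
  have hu : LinearIndependent K u := by
    refine LinearIndependent.finCons ?_ ?_
    · exact b.linearIndependent.map' (LinearMap.range f₀).subtype (Submodule.ker_subtype _)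
    · intro hmem
      apply hyn
      have hle : Submodule.span K (Set.range fun i => (b i : F)) ≤ LinearMap.range f₀ := by
        rw [Submodule.span_le]
        rintro _ ⟨i, rfl⟩
        exact (b i).2
      exact hle hmem
  obtain ⟨s, hs⟩ := Infinite.exists_notMem_finset
    ((finite_setOf_not_linearIndependent_add_smul hu u').toFinset ∪ {0})
  simp only [Finset.mem_union, Set.Finite.mem_toFinset, Set.mem_setOf_eq, Finset.mem_singleton,
    not_or, not_not] at hs
  obtain ⟨hsli, hs0⟩ := hs
  -- all vectors `u i + s • u' i` lie in `range (f₀ + s • g)`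
  have hmem : ∀ i, u i + s • u' i ∈ LinearMap.range (f₀ + s • g) := by
    refine Fin.cases ?_ ?_
    · simpa [u, u'] using hy s hs0
    · intro i
      refine ⟨w i, ?_⟩
      simp [u, u', hw i]
  -- hence `ρ + 1 ≤ finrank (range (f₀ + s • g)) ≤ ρ`
  have hli' : LinearIndependent K
      (fun i => (⟨u i + s • u' i, hmem i⟩ : LinearMap.range (f₀ + s • g))) :=
    LinearIndependent.of_comp (LinearMap.range (f₀ + s • g)).subtype hsli
  have h1 := hli'.fintype_card_le_finrank
  have h2 := hmax (f₀ + s • g) (W.add_mem hf₀ (W.smul_mem s hg))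
  simp only [Fintype.card_fin] at h1
  omega

variable {W : Submodule K (E →ₗ[K] F)} {f₀ : E →ₗ[K] F}

/-- `A₄ = 0`: if `f₀ ∈ W` has maximal rank, every `g ∈ W` maps `ker f₀` into `range f₀`
(`g v = (f₀ + s g)(s⁻¹ v)`). [folklore] -/
theorem apply_mem_range_of_mem_ker (hf₀ : f₀ ∈ W)
    (hmax : ∀ h ∈ W, Module.finrank K (LinearMap.range h) ≤ Module.finrank K (LinearMap.range f₀))
    {g : E →ₗ[K] F} (hg : g ∈ W) {v : E} (hv : f₀ v = 0) : g v ∈ LinearMap.range f₀ := by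
  refine mem_range_of_forall_mem_range_add_smul hf₀ hg hmax fun s hs => ?_
  refine ⟨s⁻¹ • v, ?_⟩
  simp [hv, smul_smul, inv_mul_cancel₀ hs]

/-- `A₃A₂ = 0`: if `f₀ ∈ W` has maximal rank, `g ∈ W`, `v ∈ ker f₀` and `f₀ w = g v`, then
`g w ∈ range f₀` (`g w = (f₀ + s g)(s⁻¹ w − s⁻² v)`). [folklore] -/
theorem apply_mem_range_of_apply_eq (hf₀ : f₀ ∈ W)
    (hmax : ∀ h ∈ W, Module.finrank K (LinearMap.range h) ≤ Module.finrank K (LinearMap.range f₀))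
    {g : E →ₗ[K] F} (hg : g ∈ W) {v w : E} (hv : f₀ v = 0) (hw : f₀ w = g v) :
    g w ∈ LinearMap.range f₀ := by
  refine mem_range_of_forall_mem_range_add_smul hf₀ hg hmax fun s hs => ?_
  refine ⟨s⁻¹ • w - (s⁻¹ * s⁻¹) • v, ?_⟩
  simp only [map_sub, map_smul, LinearMap.add_apply, LinearMap.smul_apply, hv, hw]
  rw [zero_add, smul_add, smul_smul, smul_smul, inv_mul_cancel₀ hs, one_smul,
    show s⁻¹ * s⁻¹ * s = s⁻¹ by rw [mul_assoc, inv_mul_cancel₀ hs, mul_one]]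
  abel

/-- The polarised form of `apply_mem_range_of_apply_eq`: for `g, h ∈ W`, `v ∈ ker f₀`,
`f₀ w_g = g v`, `f₀ w_h = h v` one has `h w_g + g w_h ∈ range f₀`. [folklore] -/
theorem apply_add_apply_mem_range (hf₀ : f₀ ∈ W)
    (hmax : ∀ h ∈ W, Module.finrank K (LinearMap.range h) ≤ Module.finrank K (LinearMap.range f₀))
    {g h : E →ₗ[K] F} (hg : g ∈ W) (hh : h ∈ W) {v wg wh : E} (hv : f₀ v = 0)
    (hwg : f₀ wg = g v) (hwh : f₀ wh = h v) :
    h wg + g wh ∈ LinearMap.range f₀ := by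
  have h1 := apply_mem_range_of_apply_eq hf₀ hmax (W.add_mem hg hh) (v := v) (w := wg + wh) hv
    (by simp [hwg, hwh])
  have h2 := apply_mem_range_of_apply_eq hf₀ hmax hg hv hwg
  have h3 := apply_mem_range_of_apply_eq hf₀ hmax hh hv hwh
  have heq : h wg + g wh = (g + h) (wg + wh) - g wg - h wh := by
    simp only [LinearMap.add_apply, map_add]
    abel
  rw [heq]
  exact sub_mem (sub_mem h1 h2) h3

end MaxRank



section Count

variable [FiniteDimensional K E] [FiniteDimensional K F]

/-- A space of linear maps `E → F` all vanishing on `A ≤ E` and taking values in `B ≤ F` has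
dimension at most `(dim E − dim A) · dim B` (it embeds in `Hom(E/A, B)`). [folklore] -/
theorem finrank_le_of_le_ker_of_range_le (U : Submodule K (E →ₗ[K] F)) (A : Submodule K E)
    (B : Submodule K F) (hA : ∀ g ∈ U, A ≤ LinearMap.ker g)
    (hB : ∀ g ∈ U, LinearMap.range g ≤ B) :
    Module.finrank K U ≤ (Module.finrank K E - Module.finrank K A) * Module.finrank K B := by
  let L : (E ⧸ A →ₗ[K] B) →ₗ[K] (E →ₗ[K] F) :=
    { toFun := fun χ => B.subtype ∘ₗ χ ∘ₗ A.mkQ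
      map_add' := fun χ χ' => by ext; simp
      map_smul' := fun c χ => by ext; simp }
  have hUL : U ≤ LinearMap.range L := by
    intro g hg
    let g' : E →ₗ[K] B := LinearMap.codRestrict B g fun x => hB g hg (LinearMap.mem_range_self g x)
    have hker : A ≤ LinearMap.ker g' := by
      intro a ha
      rw [LinearMap.mem_ker]
      ext
      simp [g', LinearMap.mem_ker.1 (hA g hg ha)]
    refine ⟨A.liftQ g' hker, ?_⟩
    ext x
    simp [L, g']
  calc Module.finrank K U ≤ Module.finrank K (LinearMap.range L) := Submodule.finrank_mono hUL
    _ ≤ Module.finrank K (E ⧸ A →ₗ[K] B) := LinearMap.finrank_range_le L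
    _ = (Module.finrank K E - Module.finrank K A) * Module.finrank K B := by
        rw [Module.finrank_linearMap, Submodule.finrank_quotient]

omit [FiniteDimensional K F] in
/-- Rank–nullity as an inequality for a subspace `U` and an ambient linear map `Φ`:
`dim U ≤ dim Φ(U) + dim (U ∩ ker Φ)`. [folklore] -/
theorem finrank_le_finrank_map_add (U : Submodule K E) (Φ : E →ₗ[K] F) :
    Module.finrank K U ≤
      Module.finrank K (U.map Φ) + Module.finrank K (U ⊓ LinearMap.ker Φ : Submodule K E) := by
  have h := LinearMap.finrank_range_add_finrank_ker (Φ.domRestrict U)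
  rw [LinearMap.range_domRestrict] at h
  have hk : Module.finrank K (LinearMap.ker (Φ.domRestrict U)) ≤
      Module.finrank K (U ⊓ LinearMap.ker Φ : Submodule K E) := by
    let ψ : LinearMap.ker (Φ.domRestrict U) →ₗ[K] (U ⊓ LinearMap.ker Φ : Submodule K E) :=
      LinearMap.codRestrict (U ⊓ LinearMap.ker Φ)
        (U.subtype ∘ₗ (LinearMap.ker (Φ.domRestrict U)).subtype)
        (fun x => Submodule.mem_inf.2 ⟨x.1.2, LinearMap.mem_ker.2 (by
          have h := LinearMap.mem_ker.1 x.2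
          rwa [LinearMap.domRestrict_apply] at h)⟩)
    refine LinearMap.finrank_le_finrank_of_injective (f := ψ) ?_
    intro x y hxy
    apply Subtype.ext
    apply Subtype.ext
    simpa [ψ] using congrArg Subtype.val hxy
  omega

end Count


section Main

variable [FiniteDimensional K E] [FiniteDimensional K F]

/-- **Flanders' theorem, infinite fields, relative to a member of maximal rank**: if `f₀ ∈ W` has
maximal rank `ρ` in the subspace `W ≤ (E →ₗ[K] F)`, then `dim W ≤ ρ · max(dim E, dim F)`. The
dimension count of the module docstring (restriction to `ker f₀`; reduction modulo `range f₀`;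
the remainder), using `apply_mem_range_of_mem_ker` and the polarised `apply_add_apply_mem_range`.
[cite: Flanders1962, pp. 10–16 (dimension bound `max(mr, nr)`, case of an infinite field)] -/
theorem finrank_le_of_forall_finrank_range_le_aux [Infinite K] (W : Submodule K (E →ₗ[K] F))
    {f₀ : E →ₗ[K] F} (hf₀ : f₀ ∈ W)
    (hmax : ∀ h ∈ W, Module.finrank K (LinearMap.range h) ≤ Module.finrank K (LinearMap.range f₀)) :
    Module.finrank K W ≤
      Module.finrank K (LinearMap.range f₀) * max (Module.finrank K E) (Module.finrank K F) := by
  classical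
  set ρ := Module.finrank K (LinearMap.range f₀) with hρ
  set E₀ : Submodule K E := LinearMap.ker f₀ with hE₀
  set F₁ : Submodule K F := LinearMap.range f₀ with hF₁
  have hrn : ρ + Module.finrank K E₀ = Module.finrank K E :=
    LinearMap.finrank_range_add_finrank_ker f₀
  -- `S` = span of the `g v`, `g ∈ W`, `v ∈ ker f₀`; `T` = its preimage under `f₀`
  set S : Submodule K F := Submodule.span K {y | ∃ g ∈ W, ∃ v ∈ E₀, g v = y} with hS
  have hSF₁ : S ≤ F₁ := by
    rw [Submodule.span_le]
    rintro _ ⟨g, hg, v, hv, rfl⟩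
    exact apply_mem_range_of_mem_ker hf₀ hmax hg (LinearMap.mem_ker.1 hv)
  have hgvS : ∀ g ∈ W, ∀ v ∈ E₀, g v ∈ S := fun g hg v hv =>
    Submodule.subset_span ⟨g, hg, v, hv, rfl⟩
  set T : Submodule K E := S.comap f₀ with hT
  have hE₀T : E₀ ≤ T := fun v hv => by
    rw [Submodule.mem_comap, LinearMap.mem_ker.1 hv]
    exact S.zero_mem
  have hsρ : Module.finrank K S ≤ ρ := Submodule.finrank_mono hSF₁
  have hT_dim : Module.finrank K E₀ + Module.finrank K S ≤ Module.finrank K T := by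
    have h := LinearMap.finrank_range_add_finrank_ker (f₀.domRestrict T)
    rw [LinearMap.range_domRestrict, Submodule.map_comap_eq, inf_eq_right.2 hSF₁] at h
    have hk : Module.finrank K E₀ ≤ Module.finrank K (LinearMap.ker (f₀.domRestrict T)) := by
      let ψ : E₀ →ₗ[K] LinearMap.ker (f₀.domRestrict T) :=
        LinearMap.codRestrict _ (LinearMap.codRestrict T E₀.subtype fun v => hE₀T v.2) (fun v =>
          LinearMap.mem_ker.2 (by
            rw [LinearMap.domRestrict_apply]
            exact LinearMap.mem_ker.1 v.2))
      refine LinearMap.finrank_le_finrank_of_injective (f := ψ) fun x y hxy => ?_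
      apply Subtype.ext
      have := congrArg Subtype.val (congrArg Subtype.val hxy)
      simpa [ψ] using this
    omega
  -- maps of `W` vanishing on `ker f₀` send `T` into `range f₀`
  have hkey : ∀ g ∈ W, (∀ v ∈ E₀, g v = 0) → ∀ w ∈ T, g w ∈ F₁ := by
    intro g hg hg0 w hw
    rw [Submodule.mem_comap] at hw
    suffices main : ∀ y ∈ S, ∀ w, f₀ w = y → g w ∈ F₁ from main _ hw w rfl
    intro y hy
    induction hy using Submodule.span_induction with
    | mem y hy =>
      obtain ⟨h, hh, v, hv, rfl⟩ := hy
      intro w hw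
      have hv0 : f₀ v = 0 := LinearMap.mem_ker.1 hv
      have := apply_add_apply_mem_range hf₀ hmax hg hh (v := v) (wg := 0) (wh := w) hv0
        (by rw [map_zero, hg0 v hv]) hw
      rw [map_zero, zero_add] at this
      exact this
    | zero =>
      intro w hw
      rw [hg0 w (LinearMap.mem_ker.2 hw)]
      exact F₁.zero_mem
    | add y₁ y₂ hy₁ hy₂ ih₁ ih₂ =>
      intro w hw
      obtain ⟨w₁, hw₁⟩ := LinearMap.mem_range.1 (hSF₁ hy₁)
      have hw₂ : f₀ (w - w₁) = y₂ := by rw [map_sub, hw, hw₁, add_sub_cancel_left]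
      have := F₁.add_mem (ih₁ w₁ hw₁) (ih₂ (w - w₁) hw₂)
      simpa using this
    | smul c y hy ih =>
      intro w hw
      by_cases hc : c = 0
      · subst hc
        rw [zero_smul] at hw
        rw [hg0 w (LinearMap.mem_ker.2 hw)]
        exact F₁.zero_mem
      · have h' := ih (c⁻¹ • w) (by rw [map_smul, hw, smul_smul, inv_mul_cancel₀ hc, one_smul])
        have := F₁.smul_mem c h'
        simpa [smul_smul, mul_inv_cancel₀ hc] using this
  -- the two maps used to filter `W`
  let Φ₁ : (E →ₗ[K] F) →ₗ[K] (E₀ →ₗ[K] F) :=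
    { toFun := fun g => g ∘ₗ E₀.subtype
      map_add' := fun _ _ => by ext; simp
      map_smul' := fun _ _ => by ext; simp }
  let Φ₂ : (E →ₗ[K] F) →ₗ[K] (E →ₗ[K] F ⧸ F₁) :=
    { toFun := fun g => F₁.mkQ ∘ₗ g
      map_add' := fun _ _ => by ext; simp
      map_smul' := fun _ _ => by ext; simp }
  have h1 := finrank_le_finrank_map_add W Φ₁
  have h2 := finrank_le_finrank_map_add (W ⊓ LinearMap.ker Φ₁) Φ₂
  -- (i) restrictions to `ker f₀` take values in `S`
  have hb1 : Module.finrank K (W.map Φ₁) ≤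
      (Module.finrank K E₀ - Module.finrank K (⊥ : Submodule K E₀)) * Module.finrank K S := by
    refine finrank_le_of_le_ker_of_range_le (E := E₀) _ ⊥ S (fun _ _ => bot_le) ?_
    rintro _ ⟨g, hg, rfl⟩
    rintro _ ⟨v, rfl⟩
    exact hgvS g hg v v.2
  -- (ii) maps vanishing on `ker f₀`, modulo `range f₀`, vanish on `T`
  have hb2 : Module.finrank K ((W ⊓ LinearMap.ker Φ₁).map Φ₂) ≤
      (Module.finrank K E - Module.finrank K T) *
        Module.finrank K (⊤ : Submodule K (F ⧸ F₁)) := by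
    refine finrank_le_of_le_ker_of_range_le _ T ⊤ ?_ (fun _ _ => le_top)
    rintro _ ⟨g, hg, rfl⟩ w hw
    obtain ⟨hgW, hgker⟩ := Submodule.mem_inf.1 hg
    have hg0 : ∀ v ∈ E₀, g v = 0 := fun v hv => by
      have := LinearMap.congr_fun (LinearMap.mem_ker.1 hgker) ⟨v, hv⟩
      simpa [Φ₁] using this
    rw [LinearMap.mem_ker]
    have hgw := hkey g hgW hg0 w hw
    simpa [Φ₂] using hgw
  -- (iii) the rest vanish on `ker f₀` and take values in `range f₀`
  have hb3 : Module.finrank K (W ⊓ LinearMap.ker Φ₁ ⊓ LinearMap.ker Φ₂ : Submodule K (E →ₗ[K] F)) ≤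
      (Module.finrank K E - Module.finrank K E₀) * Module.finrank K F₁ := by
    refine finrank_le_of_le_ker_of_range_le _ E₀ F₁ ?_ ?_
    · intro g hg v hv
      obtain ⟨hg1, -⟩ := Submodule.mem_inf.1 hg
      obtain ⟨-, hgker⟩ := Submodule.mem_inf.1 hg1
      have := LinearMap.congr_fun (LinearMap.mem_ker.1 hgker) ⟨v, hv⟩
      simpa [Φ₁] using this
    · intro g hg
      obtain ⟨-, hgker2⟩ := Submodule.mem_inf.1 hg
      rintro _ ⟨x, rfl⟩
      have := LinearMap.congr_fun (LinearMap.mem_ker.1 hgker2) x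
      simpa [Φ₂] using this
  -- arithmetic
  rw [finrank_bot, Nat.sub_zero] at hb1
  rw [finrank_top, Submodule.finrank_quotient] at hb2
  have htn : Module.finrank K T ≤ Module.finrank K E := Submodule.finrank_le T
  have hρm : ρ ≤ Module.finrank K F := Submodule.finrank_le F₁
  have hne : Module.finrank K E - Module.finrank K E₀ = ρ := by omega
  rw [hne] at hb3
  set n := Module.finrank K E with hn
  set m := Module.finrank K F with hm
  set e₀ := Module.finrank K E₀ with he₀
  set s := Module.finrank K S with hs
  set t := Module.finrank K T with ht
  set a := n - t with ha
  set b := m - ρ with hb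
  have has : s + a ≤ ρ := by omega
  have hbm : b + ρ = m := by omega
  have hW : Module.finrank K W ≤ e₀ * s + a * b + ρ * ρ := by linarith
  obtain hnm | hmn := le_total n m
  · rw [max_eq_right hnm]
    have he₀b : e₀ ≤ b := by omega
    calc Module.finrank K W ≤ e₀ * s + a * b + ρ * ρ := hW
      _ ≤ b * s + a * b + ρ * ρ := by gcongr
      _ = (s + a) * b + ρ * ρ := by ring
      _ ≤ ρ * b + ρ * ρ := by gcongr
      _ = ρ * m := by rw [← mul_add, hbm]
  · rw [max_eq_left hmn]
    have hbe₀ : b ≤ e₀ := by omega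
    calc Module.finrank K W ≤ e₀ * s + a * b + ρ * ρ := hW
      _ ≤ e₀ * s + a * e₀ + ρ * ρ := by gcongr
      _ = e₀ * (s + a) + ρ * ρ := by ring
      _ ≤ e₀ * ρ + ρ * ρ := by gcongr
      _ = ρ * n := by rw [← hrn]; ring

/-- **Flanders' theorem (infinite fields), linear-map form**: over an infinite field `K`, a
subspace `W` of `E →ₗ[K] F` (`E`, `F` finite-dimensional) in which every map has rank `≤ r` has
`finrank W ≤ r · max (finrank E) (finrank F)` ("subspaces of `M_{m×n}` … each matrix of rank at
most `r` … have dimension at most `max(mr, nr)`", Flanders 1962 as quoted by Atkinson–Lloyd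
1980; Flanders assumes `|K| ≥ r + 1`, Meshulam 1985 removes this; only the infinite case is
proved here). [cite: Flanders1962, pp. 10–16 (dimension bound `max(mr, nr)`, case of an infinite field)] -/
theorem finrank_le_of_forall_finrank_range_le [Infinite K] (W : Submodule K (E →ₗ[K] F)) (r : ℕ)
    (hr : ∀ g ∈ W, Module.finrank K (LinearMap.range g) ≤ r) :
    Module.finrank K W ≤ r * max (Module.finrank K E) (Module.finrank K F) := by
  set R : Set ℕ :=
    (fun g : E →ₗ[K] F => Module.finrank K (LinearMap.range g)) '' (W : Set (E →ₗ[K] F)) with hR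
  have hRbdd : BddAbove R := ⟨r, by rintro _ ⟨g, hg, rfl⟩; exact hr g hg⟩
  have hRne : R.Nonempty := ⟨_, 0, W.zero_mem, rfl⟩
  obtain ⟨f₀, hf₀, hf₀eq⟩ := Nat.sSup_mem hRne hRbdd
  have hf₀eq' : Module.finrank K (LinearMap.range f₀) = sSup R := hf₀eq
  have hmax : ∀ h ∈ W, Module.finrank K (LinearMap.range h) ≤
      Module.finrank K (LinearMap.range f₀) := fun h hh => by
    rw [hf₀eq']
    exact le_csSup hRbdd ⟨h, hh, rfl⟩
  calc Module.finrank K W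
      ≤ Module.finrank K (LinearMap.range f₀) * max (Module.finrank K E) (Module.finrank K F) :=
        finrank_le_of_forall_finrank_range_le_aux W hf₀ hmax
    _ ≤ r * max (Module.finrank K E) (Module.finrank K F) := Nat.mul_le_mul_right _ (hr f₀ hf₀)

end Main

section Matrices

/-- **Flanders' theorem (infinite fields), matrix form**: over an infinite field `K`, a subspace
`W` of `m × n` matrices in which every matrix has `Matrix.rank ≤ r` satisfies
`finrank W ≤ r · max |m| |n|` — for square matrices, "a subspace of `n × n` matrices in which
every matrix has rank at most `r` must have dimension at most `rn`" (BCCGU 2017, App. B, proof of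
Prop. B.6, quoting Flanders). Via `Matrix.toLin'` from the linear-map form.
[cite: Flanders1962, pp. 10–16 (dimension bound `max(mr, nr)`, case of an infinite field)] -/
theorem finrank_le_of_forall_rank_le [Infinite K] {m n : Type*} [Fintype m] [Fintype n]
    [DecidableEq n] (W : Submodule K (_root_.Matrix m n K)) (r : ℕ) (hr : ∀ A ∈ W, A.rank ≤ r) :
    Module.finrank K W ≤ r * max (Fintype.card m) (Fintype.card n) := by
  classical
  let e : _root_.Matrix m n K ≃ₗ[K] (n → K) →ₗ[K] (m → K) := Matrix.toLin'
  have h := finrank_le_of_forall_finrank_range_le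
    (W.map (e : _root_.Matrix m n K →ₗ[K] ((n → K) →ₗ[K] (m → K)))) r ?_
  · rw [LinearEquiv.finrank_map_eq] at h
    simpa [Module.finrank_fintype_fun_eq_card, max_comm] using h
  · rintro _ ⟨A, hA, rfl⟩
    change Module.finrank K (LinearMap.range (Matrix.toLin' A)) ≤ r
    rw [Matrix.toLin'_apply']
    exact hr A hA

end Matrices

end Literature.LinearAlgebra.Matrix
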